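import Summits.ABC.IUTFork.Cor312NaiveProvPinnedShells
import HarnessLib

/-!
# REPAIR branch B1 / CandMochizuki6TensorShells — a TWO-SUMMAND tensor-packet carrier with PRODUCT-IDEAL regions, and its typed Thm. 3.11

TOY MODEL DATA + proof (no `Prop` fact; nothing asserted about print; class `Mochizuki`, sub-cell B1, seat abc-iut-rp-m2 gen 3; Part I of
two — Part II = `Repair/CandMochizuki6TensorTwin`). TAKES NO SIDE on [IUTchIII] Cor. 3.12 or on any author; typed ≠ proved; instantiated ≠
endorsed. S. Mochizuki, *IUT III*, kurims (May 2020) = `paper:url-4b091feeb646`: Prop. 3.2 (tensor packets `log(^{S±}𝒟_{v_ℚ}) = ⊗_i ⊕_{v|v_ℚ}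
log(𝒟_v)`), Rmk. 3.9.5 (i)/(ii) (hull-sets `λ·𝒪`), Thm. 3.11 (i)(ii)(iii).

WHY. The B1 separations of record — abc-iut-w4-d021's `volumeIdentity_not_sufficient` (p430443), gen 2's `reading0_not_hull_level` (p433373),
gen 3's `shape_barrier` / `consequence_of_volumePinned` (p438139 / p439214) — all realise «equal log-volume, different region» with a SPHERE
`S_1` against a ball `B_2` and the accident `μ(S_1) = μ(B_2)` at `p = 2`; their honest scope says so («balls ∪ spheres model nothing of the
intended λ·𝒪»). On a VOLUME-INJECTIVE carrier the phenomenon cannot occur (abc-iut-w5-d098 `volumePinned_iff_residual_of_injective`). But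
print's tensor packets have SEVERAL DIRECT SUMMANDS (`⊕_{v | v_ℚ}`), and on such a packet the honest hull-sets `λ·𝒪 = (p^a 𝒪) ⊗ … ⊕ (p^b 𝒪) …`
are NOT volume-injective: `vol(B_{3,1}) = vol(B_{2,2})`, `B_{3,1} ≠ B_{2,2}`, at EVERY prime. THIS FILE builds that carrier over abc-iut-w4-d026's
index-generic sign shells (`Cor312Vol.NaiveProv`, p-ids of record): the index `biIndex` (TWO valuations `false, true` over ONE place, `l⋆ = 2`,
both bad); the summand coordinates `co b` (= NaiveProv's `coordAt` at the fibre point `b`); the sign action of the WHOLE ⟨(Ind1) ∪ (Ind2)⟩-group on EVERY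
summand coordinate is w4-d026 gen 3's `ActsBySignsAll` (`Cor312NaiveProvPinnedShells`, by name); §3 the BI-CYLINDERS
`B_{a,b} := {v_p(co false) ≥ a} ∩ {v_p(co true) ≥ b}` (product ideals), points `pt2 (p^a) (p^b)`, containment criterion, injectivity, fixed by
the (Ind)-group; §4 the honest volume `μ(B_{a,b}) = −(a+b)·log p`, monotone; §5 the Thm-3.11 data `tdata` (admissible = bi-cylinders), the
column `tcolumn` (NaiveProv's column with admissibility / volume / unit images read on bi-cylinders), the full situation `tfull`, and
**`tfull_statement`: the typed Theorem 3.11 (i) ∧ (ii) ∧ (iii) HOLDS** (every prime), `tfull_kummerB`. HONEST SCOPE: a `ℚ`-linear toy of the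
TYPED interface with sign indeterminacies; the two summands are two valuations over one rational place (as in print), the regions are product
ideals (as `λ·𝒪` is); theta data are NaiveProv's sign-saturated theta vectors. [claim: Mochizuki2012, status: disputed]
-/

noncomputable section

open Set

namespace Summit.ABC.IUTFork.Repair.CandMochizuki6Tensor

open Thm311 Cor312 Cor312.IdentifiedNonVacuity Cor312Vol Cor312Vol.NaiveProv Literature.IUT.LogThetaLattice

/-! ## 1. (The sign action of the whole ⟨(Ind1) ∪ (Ind2)⟩-group at EVERY summand coordinate is abc-iut-w4-d026 gen 3's
`Cor312Vol.NaiveProv.ActsBySignsAll` / `actsBySignsAll_of_mem_closure`, `Cor312NaiveProvPinnedShells` — consumed by name.) -/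

/-! ## 2. The index: TWO valuations over ONE rational place -/

/-- **The two-summand index**: `l⋆ = 2`, valuations `𝕍 = 𝕍^bad = Bool` over the single place `𝕍_ℚ = Unit`, all nonarchimedean (an `abbrev`, so
`biIndex.V = Bool`, `biIndex.VQ = Unit` reduce). The 1-packet is `ℚ ⊕ ℚ`, the `(j+1)`-packet `⊗^{j+1}(ℚ ⊕ ℚ)`. TOY MODEL DATA. [claim: Mochizuki2012, status: disputed] -/
abbrev biIndex : ThetaIndex where
  lstar := 2
  two_le_lstar := le_rfl
  V := Bool
  VQ := Unit
  over := fun _ => ()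
  IsNon := fun _ => True
  fibre_finite := fun _ => Set.toFinite _
  fibre_nonempty := fun _ => ⟨true, rfl⟩
  Vbad := Set.univ
  Vbad_nonempty := ⟨true, trivial⟩
  Vbad_finite := Set.toFinite _
  Vbad_non := fun _ _ => trivial

/-- The fibre point `b` over the place `v_ℚ`. [folklore] -/
def fib (vQ : biIndex.VQ) (b : Bool) : biIndex.Fibre vQ := ⟨b, Subsingleton.elim _ _⟩

/-- The SUMMAND COORDINATE `co b` of the tensor packet: the product over the tensor factors of the `b`-components (NaiveProv's `coordAt` at `b`). [folklore] -/
def co (b : Bool) (j : biIndex.Label) (vQ : biIndex.VQ) : (signShells biIndex).Packet j vQ →ₗ[ℚ] ℚ := coordAt j vQ (fib vQ b)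

/-! ## 3. Bi-cylinders `B_{a,b}` (product ideals), points, containment, (Ind)-stability -/

variable (p : ℕ)

/-- The cylinder of `p`-adic radius `p^{-k}` along the summand coordinate `b`. [folklore] -/
def cyl (b : Bool) (j : biIndex.Label) (vQ : biIndex.VQ) (k : ℤ) : Set ((signShells biIndex).Packet j vQ) :=
  {x | co b j vQ x = 0 ∨ k ≤ padicValRat p (co b j vQ x)}

/-- **The BI-CYLINDER `B_{a,b}`**: valuation `≥ a` along the summand `false` AND `≥ b` along the summand `true` — the product ideal
`(p^a 𝒪) ⊠ (p^b 𝒪)` of the two-summand packet (the shape of a hull-set `λ·𝒪`, `λ = (p^a, p^b)`). TOY MODEL DATA. [claim: Mochizuki2012, status: disputed] -/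
def biBall (j : biIndex.Label) (vQ : biIndex.VQ) (a b : ℤ) : Set ((signShells biIndex).Packet j vQ) := cyl p false j vQ a ∩ cyl p true j vQ b

/-- `0 ∈ B_{a,b}`. [folklore] -/
theorem zero_mem_biBall (j : biIndex.Label) (vQ : biIndex.VQ) (a b : ℤ) : (0 : (signShells biIndex).Packet j vQ) ∈ biBall p j vQ a b :=
  ⟨Or.inl (map_zero _), Or.inl (map_zero _)⟩

/-- The pure tensor whose factor `0` is `(x, y) ∈ ℚ ⊕ ℚ` and whose other factors are `(1, 1)`. [folklore] -/
def pt2 (j : biIndex.Label) (vQ : biIndex.VQ) (x y : ℚ) : (signShells biIndex).Packet j vQ :=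
  PiTensorProduct.tprod ℚ fun (i : biIndex.Caps j) (w : biIndex.Fibre vQ) => if i = 0 then (if w.1 then y else x) else 1

/-- Its summand coordinates are `x` (at `false`) and `y` (at `true`). [folklore] -/
theorem co_pt2 (b : Bool) (j : biIndex.Label) (vQ : biIndex.VQ) (x y : ℚ) : co b j vQ (pt2 j vQ x y) = if b then y else x := by
  unfold co pt2
  rw [coordAt_tprod]
  rw [Finset.prod_eq_single (0 : biIndex.Caps j) (fun i _ hi => by simp [hi]) (fun h => absurd (Finset.mem_univ _) h)]
  cases b <;> simp [fib]

variable [hp : Fact p.Prime]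

/-- `p^k ≠ 0`. [folklore] -/
theorem ppow_ne_zero (k : ℤ) : ((p : ℚ) ^ k) ≠ 0 := zpow_ne_zero k (Nat.cast_ne_zero.mpr hp.out.ne_zero)

/-- **Membership criterion**: `pt2 (p^a) (p^b) ∈ B_{a',b'} ⟺ a' ≤ a ∧ b' ≤ b`. [folklore] -/
theorem pt2_mem_biBall_iff (j : biIndex.Label) (vQ : biIndex.VQ) (a b a' b' : ℤ) :
    pt2 j vQ ((p : ℚ) ^ a) ((p : ℚ) ^ b) ∈ biBall p j vQ a' b' ↔ a' ≤ a ∧ b' ≤ b := by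
  show (co false j vQ _ = 0 ∨ _) ∧ (co true j vQ _ = 0 ∨ _) ↔ _
  simp only [co_pt2, NaiveWitness.padicValRat_ppow, ppow_ne_zero, false_or, Bool.false_eq_true, if_false, if_true]

/-- **Containment criterion**: `B_{a,b} ⊆ B_{a',b'} ⟺ a' ≤ a ∧ b' ≤ b`. [folklore] -/
theorem biBall_subset_iff (j : biIndex.Label) (vQ : biIndex.VQ) (a b a' b' : ℤ) :
    biBall p j vQ a b ⊆ biBall p j vQ a' b' ↔ a' ≤ a ∧ b' ≤ b := by
  constructor
  · intro h
    exact (pt2_mem_biBall_iff p j vQ a b a' b').1 (h ((pt2_mem_biBall_iff p j vQ a b a b).2 ⟨le_rfl, le_rfl⟩))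
  · rintro ⟨ha, hb⟩ x ⟨hx0, hx1⟩
    exact ⟨hx0.imp_right fun h => ha.trans h, hx1.imp_right fun h => hb.trans h⟩

/-- The bi-cylinders are pairwise distinct: `(a,b) ↦ B_{a,b}` is injective. [folklore] -/
theorem biBall_injective (j : biIndex.Label) (vQ : biIndex.VQ) {a b a' b' : ℤ} (h : biBall p j vQ a b = biBall p j vQ a' b') : a = a' ∧ b = b' := by
  have h1 := (biBall_subset_iff p j vQ a b a' b').1 h.le
  have h2 := (biBall_subset_iff p j vQ a' b' a b).1 h.ge
  omega

omit hp in
/-- A family acting by signs at every summand (w4-d026's `ActsBySignsAll`) FIXES every bi-cylinder. [folklore] -/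
theorem image_biBall_of_signs {Φ : (signShells biIndex).PacketAut} (h : ActsBySignsAll Φ) (j : biIndex.Label) (vQ : biIndex.VQ) (a b : ℤ) :
    Φ j vQ '' biBall p j vQ a b = biBall p j vQ a b := by
  obtain ⟨ε, hε, hΦε⟩ := h.sign j vQ (fib vQ false)
  obtain ⟨δ, hδ, hΦδ⟩ := h.sign j vQ (fib vQ true)
  have key : ∀ x, Φ j vQ x ∈ biBall p j vQ a b ↔ x ∈ biBall p j vQ a b := fun x => by
    show (co false j vQ (Φ j vQ x) = 0 ∨ _) ∧ (co true j vQ (Φ j vQ x) = 0 ∨ _) ↔ (co false j vQ x = 0 ∨ _) ∧ (co true j vQ x = 0 ∨ _)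
    unfold co
    rw [hΦε, hΦδ, NaiveWitness.sign_mul_mem_pBall_iff p hε, NaiveWitness.sign_mul_mem_pBall_iff p hδ]
  apply Set.Subset.antisymm
  · rintro _ ⟨x, hx, rfl⟩; exact (key x).2 hx
  · intro x hx
    refine ⟨(Φ j vQ).symm x, ?_, LinearEquiv.apply_symm_apply _ _⟩
    rw [← key, LinearEquiv.apply_symm_apply]; exact hx

omit hp in
/-- **Every element of the (Ind1),(Ind2)-group fixes every bi-cylinder.** [folklore] -/
theorem image_biBall_of_mem_closure {Φ : (signShells biIndex).PacketAut}
    (h : Φ ∈ Subgroup.closure ((signShells biIndex).Ind1Family ∪ (signShells biIndex).Ind2Family)) (j : biIndex.Label) (vQ : biIndex.VQ) (a b : ℤ) :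
    Φ j vQ '' biBall p j vQ a b = biBall p j vQ a b :=
  image_biBall_of_signs p (actsBySignsAll_of_mem_closure h) j vQ a b

omit hp in
/-- NaiveProv's Kummer twist (`1` or `negFamily ∈ (Ind2)`) fixes every bi-cylinder. [folklore] -/
theorem image_biBall_twist (m : ℤ) (j : biIndex.Label) (vQ : biIndex.VQ) (a b : ℤ) :
    twist m j vQ '' biBall p j vQ a b = biBall p j vQ a b := by
  have h : (twist m : (signShells biIndex).PacketAut) ∈ Subgroup.closure ((signShells biIndex).Ind1Family ∪ (signShells biIndex).Ind2Family) := by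
    unfold twist
    split_ifs
    · exact (Subgroup.closure _).one_mem
    · exact Subgroup.subset_closure (Or.inr negFamily_mem_Ind2Family)
  exact image_biBall_of_mem_closure p h j vQ a b

/-! ## 4. The honest volume `μ(B_{a,b}) = −(a+b)·log p` -/

open scoped Classical in
/-- The LOG-VOLUME of the two-summand model: `μ(B_{a,b}) = −(a+b)·log p` (Haar measure of the product ideal, normalised by `μ(B_{0,0}) = 0`),
`0` on non-bi-cylinders (never evaluated). [folklore] -/
def bvol (j : biIndex.Label) (vQ : biIndex.VQ) (A : Set ((signShells biIndex).Packet j vQ)) : ℝ :=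
  if h : ∃ ab : ℤ × ℤ, A = biBall p j vQ ab.1 ab.2 then -((h.choose.1 + h.choose.2 : ℤ) : ℝ) * Real.log p else 0

/-- `μ(B_{a,b}) = −(a+b)·log p`. [folklore] -/
theorem bvol_biBall (j : biIndex.Label) (vQ : biIndex.VQ) (a b : ℤ) : bvol p j vQ (biBall p j vQ a b) = -((a + b : ℤ) : ℝ) * Real.log p := by
  classical
  have h : ∃ ab : ℤ × ℤ, biBall p j vQ a b = biBall p j vQ ab.1 ab.2 := ⟨(a, b), rfl⟩
  unfold bvol
  rw [dif_pos h]
  obtain ⟨h1, h2⟩ := biBall_injective p j vQ h.choose_spec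
  rw [← h1, ← h2]

/-- The volume is MONOTONE on bi-cylinders. [folklore] -/
theorem bvol_mono {j : biIndex.Label} {vQ : biIndex.VQ} {a b a' b' : ℤ} (h : biBall p j vQ a b ⊆ biBall p j vQ a' b') :
    bvol p j vQ (biBall p j vQ a b) ≤ bvol p j vQ (biBall p j vQ a' b') := by
  rw [bvol_biBall, bvol_biBall]
  obtain ⟨ha, hb⟩ := (biBall_subset_iff p j vQ a b a' b').1 h
  have hl := NaiveWitness.log_p_pos p
  have : ((a' + b' : ℤ) : ℝ) ≤ ((a + b : ℤ) : ℝ) := by exact_mod_cast add_le_add ha hb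
  nlinarith

/-! ## 5. The Thm-3.11 data, column and full situation of the two-summand model; the typed Theorem 3.11 holds -/

/-- **The data (a)(b)(c)**: integral structures the unit bi-cylinders `B_{0,0}`, admissible regions the bi-cylinders, log-volume `bvol`; splitting
monoids NaiveProv's sign-saturated theta vectors `Ψ_v` at both valuations, acting by the coordinate; number-field copy everything.
[claim: Mochizuki2012, status: disputed] -/
def tdata : MRData (signShells biIndex) where
  shellPk := fun j vQ => biBall p j vQ 0 0
  shellSub := fun j v => biBall p j (biIndex.over v) 0 0
  Adm := fun j vQ A => ∃ a b : ℤ, A = biBall p j vQ a b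
  logvol := fun j vQ A => bvol p j vQ A
  Ψ := fun v _ => Psi p v
  act := fun v _ y => LinearMap.pi fun j => (coord j.1 (biIndex.over v) (y j)) • LinearMap.proj j
  Mmod := fun _ => Set.univ

/-- **(c)'s global realified Frobenioids**: objects `k ∈ ℤ` («`p^k 𝒪_K`»), degree `−2k·log p`, region the diagonal bi-cylinder `B_{k,k}`. [claim: Mochizuki2012, status: disputed] -/
def tdegrees (j : biIndex.LabelStar) : GlobalDegrees (signShells biIndex) j where
  ObjMOD := ℤ
  Objmod := ℤ
  natIso := Equiv.refl ℤ
  deg := fun k => -((k + k : ℤ) : ℝ) * Real.log p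
  region := fun k vQ => biBall p j.1 vQ k k

/-- The SITUATION of the two-summand model (an `abbrev`: `.L` reduces to `signShells biIndex`). [claim: Mochizuki2012, status: disputed] -/
abbrev tsituation : Situation biIndex where
  L := signShells biIndex
  D := fun _ => tdata p
  G := fun _ j => tdegrees p j

/-- **The column**: NaiveProv's column (sign-twisted Kummer transport, tagged Frobenioid objects, Θ-pilot of index `1`) with the Frobenius-like
admissibility / log-volume the twisted transports of the BI-CYLINDER data and unit / ball images the diagonal bi-cylinders. [claim: Mochizuki2012, status: disputed] -/
def tcolumn : Column (signShells biIndex) :=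
  { NaiveProv.column p () (Real.log p) with
    frobAdm := fun m j vQ A => ∃ a b : ℤ, twist m j vQ '' A = biBall p j vQ a b
    frobLogvol := fun m j vQ A => bvol p j vQ (twist m j vQ '' A)
    unitImage := fun _ m' j vQ => biBall p j vQ ((m' : ℤ) + 1) ((m' : ℤ) + 1)
    ballImage := fun _ j vQ => biBall p j vQ 0 0 }

/-- **The full situation** of the two-summand model: the situation, the same column everywhere, abc-iut-w5-d247's link data. [claim: Mochizuki2012, status: disputed] -/
abbrev tfull : FullSituation biIndex where
  toSituation := tsituation p
  col := fun _ => tcolumn p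
  link := NaiveWitness.naiveLink

/-- (i): splitting monoids in the sub-packets (NaiveProv); the degree `−2k·log p` of `p^k𝒪` IS the global log-volume of `B_{k,k}`; classes coincide. [folklore] -/
theorem tfull_partI : (tfull p).PartI := by
  refine ⟨fun n v hv x hx j => Psi_subPacket p v hx j, fun n j k => ⟨fun vQ => ⟨k, k, rfl⟩, Set.toFinite _, ?_⟩, fun _ _ => rfl⟩
  rw [finsum_unique]
  exact (bvol_biBall p j.1 _ k k).symm

omit hp in
/-- (ii): KummerA (the twist fixes bi-cylinders), KummerB (sign-saturation of `Ψ_v`), KummerC (onto), (Ind3) (`B_{m'+1,m'+1} ⊆ B_{0,0}`). [folklore] -/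
theorem tfull_partII : (tfull p).toLatticeSituation.PartII := by
  intro n
  refine (Column.partII_iff _ _).2 ⟨?_, fun m v hv => image_Psi_twist p m v,
    fun m j => Set.image_univ_of_surjective ((signShells biIndex).globalAut (twist m) j.1).surjective, ?_, ?_⟩
  · rintro m j vQ A ⟨a, b, rfl⟩
    exact ⟨⟨a, b, image_biBall_twist p m j vQ a b⟩, by
      show bvol p j vQ (twist m j vQ '' biBall p j vQ a b) = bvol p j vQ (biBall p j vQ a b)
      rw [image_biBall_twist]⟩
  · intro m m' j vQ _
    show biBall p j vQ ((m' : ℤ) + 1) ((m' : ℤ) + 1) ⊆ biBall p j vQ 0 0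
    rintro x ⟨h0, h1⟩
    exact ⟨h0.imp_right fun h => le_trans (by omega) h, h1.imp_right fun h => le_trans (by omega) h⟩
  · intro m j vQ h; exact absurd trivial h

/-- (iii): as in NaiveProv (the link data and objects are unchanged). [folklore] -/
theorem tfull_partIII : (tfull p).PartIII := by
  refine ⟨NaiveWitness.naiveLink.partIIIa_holds, NaiveWitness.naiveLink.partIIIb_holds, ?_, ?_,
    (tfull p).evalCompatUpToInd_of_multiradialCompat (tfull_partI p).2.2⟩
  · refine NaiveWitness.naiveLink.partIIIc_of_full (fun _ => rfl) fun n m => ?_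
    rintro _ ⟨a, rfl⟩
    show NaiveWitness.unitIso a ≪≫ NaiveWitness.unitIso ((-1) ^ m.natAbs) =
      NaiveWitness.unitIso ((-1) ^ m.natAbs) ≪≫ NaiveWitness.unitIso a
    rw [NaiveWitness.unitIso_trans, NaiveWitness.unitIso_trans, mul_comm]
  · intro n m; exact Thm311.PolyIsoCalc.stabilized_full _ _

/-- **The typed Theorem 3.11 (i) ∧ (ii) ∧ (iii) HOLDS in the two-summand model**, at every prime. [folklore] -/
theorem tfull_statement : (tfull p).Statement := ⟨tfull_partI p, tfull_partII p, tfull_partIII p⟩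

omit hp in
/-- Thm. 3.11 (ii)(b) for every column: the Frobenius-like Kummer images are `Ψ_v` itself. [folklore] -/
theorem tfull_kummerB (n : ℤ) : ((tfull p).toLatticeSituation.col n).KummerB ((tfull p).toLatticeSituation.D n) := fun m v _ =>
  image_Psi_twist p m v

omit hp in
/-- The splitting monoids are nonempty (the theta tuple). [folklore] -/
theorem tPsi_nonempty (n : ℤ) (v : biIndex.V) (hv : v ∈ biIndex.Vbad) : (((tfull p).toLatticeSituation.D n).Ψ v hv).Nonempty :=
  ⟨_, thetaTuple_mem_Psi p v⟩

end Summit.ABC.IUTFork.Repair.CandMochizuki6Tensor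

end
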